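import Literature.NumberTheory.EllipticCurves.ProfiniteGroupDistributionRing

/-!
# STUB-IDEAS k3 (gen 29) — R191′ EXECUTED: the (2)₂ identification `R175` by «LOG ⊕ TABLE» at `v`,
# with the UP–TWIST–DOWN descent AT `v` computed as the cross-check (glue PROVED below)

Stub-ideation sketch (planner, k = 3, gen 29, TECHNIQUE «decomposition: sub-stubs + a provable glue»)
for STUB `stub_heegnerIndexLowerAtTwo` of crux `SplitBadTwoLowerHalfOfFacts`
(stmt-BirchSwinnertonDyer-27851, route PrintCf2).  It is NOT a proof of the stub, of the crux, of
(2)₂/(3)₂, or of BSD.  Critic target: STUB-PLAN v5.4 research set `{R175}` and probe **R191′**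
(«R175 BY DESCENT AT v»): run row 81's UP–TWIST–DOWN for the (2)₂ identification.

## Dictionary (split-bad CM class: `W = A^{(d)}`, `A = 49a1`, `K₀ = ℚ(√-7)`, `2 = v v̄`, `v` the prime at
## which the member is the CONNECTED one, `T_vW|_{G_v} ≅ ℤ₂(1) ⊗ ρ_v`, `ρ_v = ρ^{ur}·χ_{d,v}`)

* `G`, `𝒰` — `Γ⁺ = Gal(line⁺/ℚ₂)`, `line⁺ := K₀(𝔤_W v^e v̄^∞)_v ⊇ ℚ₂^{ur,2}·ℚ₂(√d)` (k3-g24's `𝒢′` read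
  at `v`; `e = twistCondExp d ∈ {2,3}`), with its level tower; `𝕜` — a complete non-archimedean field
  containing `K̂_v(μ_{2^e}, √d)` (values of characters, Gauss sums, logarithms).
* `katz : GroupDistribution 𝒰 𝕜` — `π_* μ_𝔞^{(v)}`: de Shalit's integral measure built with `𝔭 := v`
  (II.4.12, tree `DeShalit1987.thmII414_exists_lMeasure`, `GroupDistribution.twisting`,
  `GroupDistribution.exists_glue_twisting_*` = II.4.14 Step 1), pushed to `Γ⁺` (k3-g24 `F.katz`).
* `col : GroupDistribution 𝒰 𝕜` — `Λog(e(𝔞)|_{line⁺})`: the UNRAMIFIED-LOGARITHM distribution of the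
  restricted elliptic-unit norm system (masses `log_v(σ̃ e_m)`; k3-g24's atom A `unitLogDistribution`);
  sub-stub S1 below upgrades it to the module-level Coleman map `Col⁺` of the line.
* `C : GroupDistribution 𝒰 𝕜` — the EXPLICIT column element `C_v = T_v ∗ E_v ∗ R_ξ⁻¹` (Gauss-sum
  distribution on the finite inertia `I_v ⊂ Γ⁺` ∗ Euler operator `δ₁ − ½ e_{I_v} ∗ δ_{F_v⁻¹}` ∗ inverse
  resolvent of the normal-basis generator), read off de Shalit II.5.2 (3) [p. 79–80] column by column.
* `LevelChar` — finite-order characters of `Γ⁺` (factor through a level); `CharactersSeparate` — H-FI.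

## What is PROVED here (kernel-checked, no `sorry`)

§1 `masses_eq_conv_of_tables`, `conv_masses_eq_conv_of_tables`, `value_of_tables_normalised` — THE GLUE of R175: character tables `∫χ dkatz = ∫χ dC · ∫χ dcol` at every
   finite-order `χ` + separation ⟹ the identity of measures `katz = C ∗ col` (tree `integral_conv_of_mul`);
   `value_of_tables` — its corollary at ANY tower-continuous multiplicative `ρ` (the out-of-range
   `ρ_v`): `∫ρ dkatz = (∫ρ dC) · ∫ρ dcol` = k3-g24's `KLFValue F c(key)` with `c(key) := ∫ρ_v dC_v`;
   `constant_three_columns` — `∫ρ d(T ∗ (E ∗ R)) = ∫ρ dT · (∫ρ dE · ∫ρ dR)`.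
§2 `inertia_sum_eq_zero`, `eulerColumn_eq_one_of_ramified`, `eulerColumn_of_unramified` — the Euler
   column of II.5.2 (3) is `1` at `ρ_v` BECAUSE `ρ_v|_{I_v} = χ_{d,v} ≠ 1` (`¬ Good W 2` used here), and
   `1 − u/2` on `v`-unramified columns (why a SCALAR `KLFMasses` is not the Fourier inverse of (3)).
§3 `charSum_eq_masses_mul_resolvent` — the NORMALISATION column is definitional: character sums of
   conjugate logarithms = (character integral of the log-masses) × (resolvent of the normal basis).
§4 `gauss_neg_four_sq`, `gauss_eight_sq`, `gauss_neg_eight_sq` — `τ(χ_{d,v})² = χ_{d,v}(−1)·2^e`, i.e.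
   the digit `v₂ c(key) = e/2 ∈ {1, 3/2}` (B16 (iii) of record), from `ζ₈⁴ = −1` alone.
§5 `chi4_neg_one`, `chi4_five`, `chi8_five`, `chi8'_five` — the descent-obstruction character of R191′:
   `ρ_v` restricted to the descent direction `H_v = I(L_∞^{(v)}/ℚ₂^{ur,2}) ≅ ℤ₂ˣ = ⟨−1⟩ × cl⟨5⟩` is
   `χ_{d,v}|_{ℤ₂ˣ} ∈ {χ₄, χ₈, χ₈'}`, of ORDER 2 and NON-TRIVIAL in every split-bad case.
§6 `smul_sub_self_bijective_of_isUnit`, `invariants_eq_zero`, `coinvariants_onto`,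
   `isUnit_neg_one_sub_one`, `int_descent_obstruction_not_onto` — after `⊗ℚ` all `H_*(H_v, 𝕜(ρ_v))`
   vanish (`ρ_v(h₀) = −1`, `−2 ∈ 𝕜ˣ`), so UTD-at-`v` descends ISOMORPHICALLY onto the strict unramified
   line; integrally the obstruction is the `ℤ/2` of `m ↦ −2m` (harmless `⊗ℚ`, booked).

## References

* [deShalit1987] E. de Shalit, *Iwasawa theory of elliptic curves with complex multiplication* (1987):
  I.2.3 (iii) p. 14; I.3.4–3.6 pp. 17–19; I.3.8–3.9 pp. 20–21; II.4.11–4.12 pp. 66–69; II.4.14 Step 1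
  p. 71; II.5.2 (3)–(4) pp. 79–80.
* [Nekovar2006] J. Nekovář, *Selmer complexes*, Astérisque 310 (2006), 8.4.8.1–8.4.8.3 pp. 214–215.
-/

noncomputable section

open Filter Topology
open scoped Classical

namespace Summit.BirchSwinnertonDyer.BirchSwinnertonDyer.Cruxes.SplitBadTwoLowerHalfOfFacts.LogTableAtVK3G29

open Literature.NumberTheory.EllipticCurves Literature.NumberTheory.EllipticCurves.GroupDistribution

/-! ## §1  Finite-order characters of the line, separation, and THE GLUE of R175 -/

section Tables

variable {G : Type*} [CommGroup G] (𝒰 : SubgroupTower G) (𝕜 : Type*) [NormedField 𝕜]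

/-- A finite-order (level-factoring) multiplicative character of the tower `𝒰` — «every finite-order
character of `𝒢′`» in de Shalit II.5.2. [deShalit1987, II.5.2 p. 79] -/
structure LevelChar where
  /-- the character as a function on `G` -/
  toFun : G → 𝕜
  /-- multiplicativity -/
  map_mul' : ∀ σ τ, toFun (σ * τ) = toFun σ * toFun τ
  /-- a level through which it factors -/
  level : ℕ
  /-- it factors through `G ⧸ U level` -/
  factors' : ∀ σ τ, 𝒰.proj level σ = 𝒰.proj level τ → toFun σ = toFun τ

namespace LevelChar

variable {𝒰 𝕜}

/-- A level-factoring character is tower-continuous (eventually constant on cells). [folklore] -/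
theorem isTowerContinuous (χ : LevelChar 𝒰 𝕜) : 𝒰.IsTowerContinuous χ.toFun := by
  intro ε hε
  refine ⟨χ.level, fun n hn σ τ h => ?_⟩
  rw [χ.factors' σ τ (𝒰.proj_eq_of_proj_eq hn h), dist_self]
  exact hε

end LevelChar

/-- **H-FI as a hypothesis on `𝕜`**: finite-order characters SEPARATE distributions on the line
(discharge: finite Fourier inversion level by level as soon as `𝕜 ⊇ μ_{exp(G/U_n)}` for all `n`;
tree `BoundedDistribution.fourier_inversion` / `eq_zero_of_forall_sum_eq_zero` is the `ℤ_p` case,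
Mathlib `DirichletCharacter.sum_char_inv_mul_char_eq` the finite-group orthogonality). [folklore] -/
def CharactersSeparate : Prop :=
  ∀ D₁ D₂ : GroupDistribution 𝒰 𝕜,
    (∀ χ : LevelChar 𝒰 𝕜, D₁.integral χ.toFun = D₂.integral χ.toFun) → ∀ n a, D₁.μ n a = D₂.μ n a

variable {𝒰 𝕜}

/-- Distributions with the same masses have the same integrals. [folklore] -/
theorem integral_congr_μ (D₁ D₂ : GroupDistribution 𝒰 𝕜) (h : ∀ n a, D₁.μ n a = D₂.μ n a)
    (f : G → 𝕜) : D₁.integral f = D₂.integral f := by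
  have hRS : D₁.riemannSum f = D₂.riemannSum f := funext fun n => by
    simp only [GroupDistribution.riemannSum, h]
  simp only [GroupDistribution.integral, hRS]

variable [IsUltrametricDist 𝕜] [CompleteSpace 𝕜]

/-- **THE GLUE of R175 (tables + separation ⟹ identity of measures, convolution form).**  If at EVERY
finite-order character `χ` of the line the value column reads `∫χ dkatz = ∫χ dC · ∫χ dcol` (de Shalit
II.5.2 (3)–(4) at `𝔭 := v` for the value side, `charSum_eq_masses_mul_resolvent` for the normalisation
side, the columns collected into ONE distribution `C = C_v`), then `katz = C ∗ col` as measures.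
[deShalit1987, II.5.2 (3)–(4) pp. 79–80; this file] -/
theorem masses_eq_conv_of_tables (hsep : CharactersSeparate 𝒰 𝕜) (katz col C : GroupDistribution 𝒰 𝕜)
    (htab : ∀ χ : LevelChar 𝒰 𝕜,
      katz.integral χ.toFun = C.integral χ.toFun * col.integral χ.toFun) :
    ∀ n a, katz.μ n a = (conv C col).μ n a :=
  hsep katz (conv C col) fun χ => by
    rw [htab χ, integral_conv_of_mul C col χ.isTowerContinuous χ.map_mul']

/-- **VALUE COROLLARY = node (2)₂'s `KLFValue` with the constant NAMED**: at any tower-continuous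
multiplicative `ρ` (the out-of-range `ρ_v = ρ^{ur}·χ_{d,v}`), `∫ρ dkatz = (∫ρ dC) · ∫ρ dcol`; in
k3-g24's frame this is `KLFValue F c(key)` with `c(key) := ∫ρ_v dC_v`. [this file] -/
theorem value_of_tables (hsep : CharactersSeparate 𝒰 𝕜) (katz col C : GroupDistribution 𝒰 𝕜)
    (htab : ∀ χ : LevelChar 𝒰 𝕜,
      katz.integral χ.toFun = C.integral χ.toFun * col.integral χ.toFun)
    {ρ : G → 𝕜} (hρc : 𝒰.IsTowerContinuous ρ) (hρ : ∀ σ τ, ρ (σ * τ) = ρ σ * ρ τ) :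
    katz.integral ρ = C.integral ρ * col.integral ρ := by
  rw [integral_congr_μ katz (conv C col) (masses_eq_conv_of_tables hsep katz col C htab) ρ,
    integral_conv_of_mul C col hρc hρ]

/-- **NORMALISED TABLES (the universal-norm column).**  In de Shalit II.5.2 (3) the unit of level
`n(χ)` (exact `v`-conductor of `χ`) appears; rewriting every column through the ONE norm-coherent system
of `v`-level `e` costs, on the `v`-UNRAMIFIED columns only, the factor `a_v(χ) = 1 − χ(F_v)` (II.2.5:
`N e₁ = e₀^{1 − F_v⁻¹}`), i.e. a convolution by the bounded operator `𝒜_v = δ₁ − e_{I_v} ∗ δ_{F_v}` on the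
`katz` side: tables `∫χ d𝒜·∫χ dkatz = ∫χ dC · ∫χ dcol`.  At the RAMIFIED `ρ_v` one has `∫ρ_v d𝒜_v = 1`
(`eulerColumn_eq_one_of_ramified` with `q = 1`), so the value identity is unchanged — the table-side
shadow of R191′: the universal-norm defect of the Lubin–Tate direction is invisible at `ρ_v` BECAUSE
`χ_{d,v}` is ramified (`¬ Good W 2`). [deShalit1987, II.2.5, II.5.2 (3); this file] -/
theorem value_of_tables_normalised (hsep : CharactersSeparate 𝒰 𝕜)
    (A katz col C : GroupDistribution 𝒰 𝕜)
    (htab : ∀ χ : LevelChar 𝒰 𝕜,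
      A.integral χ.toFun * katz.integral χ.toFun = C.integral χ.toFun * col.integral χ.toFun)
    {ρ : G → 𝕜} (hρc : 𝒰.IsTowerContinuous ρ) (hρ : ∀ σ τ, ρ (σ * τ) = ρ σ * ρ τ)
    (hA : A.integral ρ = 1) :
    katz.integral ρ = C.integral ρ * col.integral ρ := by
  have h := value_of_tables hsep (conv A katz) col C (fun χ => by
    rw [integral_conv_of_mul A katz χ.isTowerContinuous χ.map_mul', htab χ]) hρc hρ
  rwa [integral_conv_of_mul A katz hρc hρ, hA, one_mul] at h

/-- The normalised identity of MEASURES: `𝒜_v ∗ katz = C_v ∗ col` (both sides bounded measures on the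
line; exact, no `∃`-constant). [this file] -/
theorem conv_masses_eq_conv_of_tables (hsep : CharactersSeparate 𝒰 𝕜)
    (A katz col C : GroupDistribution 𝒰 𝕜)
    (htab : ∀ χ : LevelChar 𝒰 𝕜,
      A.integral χ.toFun * katz.integral χ.toFun = C.integral χ.toFun * col.integral χ.toFun) :
    ∀ n a, (conv A katz).μ n a = (conv C col).μ n a :=
  masses_eq_conv_of_tables hsep (conv A katz) col C fun χ => by
    rw [integral_conv_of_mul A katz χ.isTowerContinuous χ.map_mul', htab χ]

/-- The constant splits along `C_v = T_v ∗ (E_v ∗ R)`: `c(key) = ∫ρ dT · (∫ρ dE · ∫ρ dR)` — Gauss digit ×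
Euler column × resolvent digit. [this file] -/
theorem constant_three_columns (T E R : GroupDistribution 𝒰 𝕜) {ρ : G → 𝕜}
    (hρc : 𝒰.IsTowerContinuous ρ) (hρ : ∀ σ τ, ρ (σ * τ) = ρ σ * ρ τ) :
    (conv T (conv E R)).integral ρ = T.integral ρ * (E.integral ρ * R.integral ρ) := by
  rw [integral_conv_of_mul T (conv E R) hρc hρ, integral_conv_of_mul E R hρc hρ]

/-- **MODULE form read at `ρ` (what k3-g26's `klf`/`hCol` consume on the line):** if moreover the
column constant is NON-ZERO at `ρ`, the two functionals «integrate `ρ` against `katz`» and «integrate `ρ`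
against `col`» determine each other — the identification is EXACT at `ρ` with the named unit `c(key)`.
[this file] -/
theorem col_value_of_tables (hsep : CharactersSeparate 𝒰 𝕜) (katz col C : GroupDistribution 𝒰 𝕜)
    (htab : ∀ χ : LevelChar 𝒰 𝕜,
      katz.integral χ.toFun = C.integral χ.toFun * col.integral χ.toFun)
    {ρ : G → 𝕜} (hρc : 𝒰.IsTowerContinuous ρ) (hρ : ∀ σ τ, ρ (σ * τ) = ρ σ * ρ τ)
    (hc : C.integral ρ ≠ 0) :
    col.integral ρ = (C.integral ρ)⁻¹ * katz.integral ρ := by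
  rw [value_of_tables hsep katz col C htab hρc hρ, ← mul_assoc, inv_mul_cancel₀ hc, one_mul]

end Tables

/-! ## §2  The Euler column of II.5.2 (3): `1` at the ramified `ρ_v`, `1 − u/2` on unramified columns -/

section Euler

variable {I : Type*} [CommGroup I] [Fintype I] {R : Type*} [CommRing R] [IsDomain R]

/-- A non-trivial character of the finite inertia group `I_v` sums to zero. [folklore] -/
theorem inertia_sum_eq_zero (χ : I →* R) (hχ : χ ≠ 1) : ∑ i, χ i = 0 :=
  sum_hom_units_eq_zero χ hχ

/-- **Euler column at a RAMIFIED character is `1`**: `E_v(ρ) = 1 − q · (Σ_{i ∈ I_v} ρ(i)) · ρ(F_v⁻¹) = 1`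
whenever `ρ|_{I_v} ≠ 1` — for the split-bad class `ρ_v|_{I_v} = χ_{d,v} ≠ 1` iff `¬ Good W 2`.
[deShalit1987, II.5.2 (3) p. 79 (the factor `1 − χ⁻¹(𝔭)/p`, present only for `𝔭 ∤ 𝔣_χ`); this file] -/
theorem eulerColumn_eq_one_of_ramified (χ : I →* R) (hχ : χ ≠ 1) (q u : R) :
    1 - q * (∑ i, χ i) * u = 1 := by
  rw [inertia_sum_eq_zero χ hχ, mul_zero, zero_mul, sub_zero]

/-- The Euler column at a `v`-UNRAMIFIED character (`χ|_{I_v} = 1`, `|I_v|` invertible): averaging over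
`I_v` is the identity and the column reads `1 − u/2`, `u = χ⁻¹(v)` — it VARIES with `χ`, which is why the
identification is a CONVOLUTION `katz = C_v ∗ col` and not a scalar multiple of the masses. [this file] -/
theorem eulerColumn_of_unramified {K : Type*} [Field K] (n : ℕ) (hn : (n : K) ≠ 0) (u : K) :
    1 - (1 / 2) * ((n : K)⁻¹ * n) * u = 1 - u / 2 := by
  rw [inv_mul_cancel₀ hn]
  ring

end Euler

/-! ## §3  The normalisation column is DEFINITIONAL (normal-basis coordinates of conjugate logarithms) -/

section Resolvent

variable {Γ : Type*} [CommGroup Γ] [Fintype Γ] {K : Type*} [CommRing K]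

/-- **Character sums of conjugate logarithms = (character integral of the log-masses) × resolvent.**
If `x(σ) = log(σ u) = Σ_τ λ(τ)·(στ)(ξ)` are the coordinates of `log u` in the normal basis `{τξ}`, then
`Σ_σ χ(σ⁻¹) x(σ) = (Σ_τ χ(τ) λ(τ)) · Σ_σ χ(σ⁻¹) ξ(σ)`: the sums appearing in de Shalit II.5.2 (3) for the
Coleman side ARE the character values of the mass-distribution `λ = Λog(u)` up to the resolvent
`r_ξ(χ̄)` — no second printed table is needed. [folklore; this file] -/
theorem charSum_eq_masses_mul_resolvent (χ : Γ →* K) (lam ξ x : Γ → K)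
    (hx : ∀ σ, x σ = ∑ τ, lam τ * ξ (σ * τ)) :
    ∑ σ, χ σ⁻¹ * x σ = (∑ τ, χ τ * lam τ) * ∑ σ, χ σ⁻¹ * ξ σ := by
  simp_rw [hx, Finset.mul_sum, Finset.sum_mul]
  conv_lhs => rw [Finset.sum_comm]
  conv_rhs => rw [Finset.sum_comm]
  refine Finset.sum_congr rfl fun τ _ => ?_
  -- reindex `σ ↦ σ * τ`
  have h := Fintype.sum_equiv (Equiv.mulRight τ)
    (fun σ => χ σ⁻¹ * (lam τ * ξ (σ * τ))) (fun σ' => χ τ * lam τ * (χ σ'⁻¹ * ξ σ')) ?_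
  · simpa using h
  · intro σ
    simp only [Equiv.coe_mulRight]
    have : χ σ⁻¹ = χ τ * χ (σ * τ)⁻¹ := by
      rw [← map_mul]; congr 1; rw [mul_inv_rev, ← mul_assoc, mul_inv_cancel, one_mul]
    rw [this]; ring

end Resolvent

/-! ## §4  The Gauss digit: `τ(χ_{d,v})² = χ_{d,v}(−1)·2^e` from `ζ₈⁴ = −1` -/

section Gauss

variable {R : Type*} [CommRing R]

/-- `e = 2` (`d ≡ 3 mod 4`, `χ_{d,v}|_{ℤ₂ˣ} = χ₄`): with `i = ζ²`, `τ(χ₄) = i − i³` and `τ² = −4`, so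
`v₂ τ = 1 = e/2`. [folklore; this file] -/
theorem gauss_neg_four_sq (ζ : R) (h : ζ ^ 4 = -1) : (ζ ^ 2 - ζ ^ 6) ^ 2 = -4 := by
  linear_combination (ζ ^ 8 - 3 * ζ ^ 4 + 4) * h

/-- `e = 3`, `χ_{d,v}|_{ℤ₂ˣ} = χ₈`: `τ(χ₈) = ζ + ζ⁷ − ζ³ − ζ⁵`, `τ² = 8`, `v₂ τ = 3/2 = e/2`. [this file] -/
theorem gauss_eight_sq (ζ : R) (h : ζ ^ 4 = -1) : (ζ + ζ ^ 7 - ζ ^ 3 - ζ ^ 5) ^ 2 = 8 := by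
  have h5 : ζ ^ 5 = -ζ := by linear_combination ζ * h
  have h7 : ζ ^ 7 = -ζ ^ 3 := by linear_combination ζ ^ 3 * h
  rw [h5, h7]
  linear_combination (4 * ζ ^ 2 - 8) * h

/-- `e = 3`, `χ_{d,v}|_{ℤ₂ˣ} = χ₈'` (`= χ₄χ₈`): `τ(χ₈') = ζ − ζ⁷ + ζ³ − ζ⁵`, `τ² = −8`, `v₂ τ = 3/2`.
[this file] -/
theorem gauss_neg_eight_sq (ζ : R) (h : ζ ^ 4 = -1) : (ζ - ζ ^ 7 + ζ ^ 3 - ζ ^ 5) ^ 2 = -8 := by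
  have h5 : ζ ^ 5 = -ζ := by linear_combination ζ * h
  have h7 : ζ ^ 7 = -ζ ^ 3 := by linear_combination ζ ^ 3 * h
  rw [h5, h7]
  linear_combination (4 * ζ ^ 2 + 8) * h

end Gauss

/-! ## §5  R191′'s obstruction character: `χ_{d,v}|_{ℤ₂ˣ}` on the descent direction `⟨−1⟩ × cl⟨5⟩` -/

section Obstruction

/-- `e = 2`: `χ₄(−1) = −1` — non-trivial on `⟨−1⟩`. [this file] -/
theorem chi4_neg_one : ZMod.χ₄ (-1 : ZMod 4) = -1 := by decide

/-- `e = 2`: `χ₄(5) = 1` — trivial on `cl⟨5⟩ = 1 + 4ℤ₂` (order exactly 2, through `⟨−1⟩`). [this file] -/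
theorem chi4_five : ZMod.χ₄ (5 : ZMod 4) = 1 := by decide

/-- `e = 3`, `χ₈`: `χ₈(5) = −1` — non-trivial on `cl⟨5⟩`. [this file] -/
theorem chi8_five : ZMod.χ₈ (5 : ZMod 8) = -1 := by decide

/-- `e = 3`, `χ₈' = χ₄χ₈`: `χ₈'(5) = −1`. [this file] -/
theorem chi8'_five : ZMod.χ₈' (5 : ZMod 8) = -1 := by decide

/-- All three are of order `2` on `(ℤ/8)ˣ` (squares of odd classes are `1 mod 8`). [this file] -/
theorem odd_sq_mod_eight : ∀ x : ZMod 8, x = 1 ∨ x = 3 ∨ x = 5 ∨ x = 7 → x * x = 1 := by decide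

end Obstruction

/-! ## §6  Descent algebra at `v`: `ρ_v(h₀) = −1` kills `H_*(H_v, 𝕜(ρ_v))` after `⊗ℚ`, not integrally -/

section Descent

variable {A : Type*} [CommRing A] {M : Type*} [AddCommGroup M] [Module A M]

/-- If `h₀` acts on `M` as multiplication by `r` with `r − 1` a UNIT, then `m ↦ h₀m − m` is bijective:
no invariants, no coinvariants. [folklore; Nekovar2006, 8.4.8.1 for where it is used] -/
theorem smul_sub_self_bijective_of_isUnit {r : A} (h : IsUnit (r - 1)) :
    Function.Bijective (fun m : M => r • m - m) := by
  obtain ⟨u, hu⟩ := h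
  have key : (fun m : M => r • m - m) = fun m => (u : A) • m := by
    funext m; rw [hu, sub_smul, one_smul]
  rw [key]
  have hb : Function.Bijective (fun m : M => u • m) := (MulAction.toPerm u).bijective
  simpa only [Units.smul_def] using hb

/-- No `h₀`-invariants (`H⁰ = 0`). [this file] -/
theorem invariants_eq_zero {r : A} (h : IsUnit (r - 1)) {m : M} (hm : r • m = m) : m = 0 := by
  have hinj := (smul_sub_self_bijective_of_isUnit (M := M) h).1
  have h0 : (fun m : M => r • m - m) m = (fun m : M => r • m - m) 0 := by
    simp only [smul_zero, sub_self, hm]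
  exact hinj h0

/-- No `h₀`-coinvariants (`H₀ = 0`: every element is of the form `h₀m′ − m′`). [this file] -/
theorem coinvariants_onto {r : A} (h : IsUnit (r - 1)) (m : M) : ∃ m' : M, r • m' - m' = m :=
  (smul_sub_self_bijective_of_isUnit (M := M) h).2 m

/-- At `v`: `ρ_v(h₀) = −1` and `−1 − 1 = −2` is a unit as soon as `2` is (after `⊗ℚ`). [this file] -/
theorem isUnit_neg_one_sub_one (h2 : IsUnit (2 : A)) : IsUnit ((-1 : A) - 1) := by
  have : ((-1 : A) - 1) = -2 := by norm_num
  rw [this]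
  exact h2.neg

/-- INTEGRALLY the obstruction survives as a `ℤ/2`: `m ↦ (−1)·m − m = −2m` is not onto `ℤ` — the
`{±1}`-torsion caveat of the two-step descent (first `1 + 4ℤ₂ ≅ ℤ₂` by Nekovář 8.4.8.3, then the finite
`⟨−1⟩` by res/cores, exact only after `⊗ℚ`). [this file] -/
theorem int_descent_obstruction_not_onto :
    ¬ Function.Surjective (fun m : ℤ => (-1 : ℤ) • m - m) := by
  intro h
  obtain ⟨m, hm⟩ := h 1
  simp only [smul_eq_mul] at hm
  omega

end Descent

end Summit.BirchSwinnertonDyer.BirchSwinnertonDyer.Cruxes.SplitBadTwoLowerHalfOfFacts.LogTableAtVK3G29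

end
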